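import Summits.AtomisticToContinuum.Crystallization.Theorems.ChartedZeroExcessLayeredLatticeLiouvilleXJ

/-!
# Zero-excess layered lattice Liouville — part XK (lens-2 g59, node «SBGlueC2 (b)»): THE ONE-STEP THEOREM `sbModeStep` with explicit constants

Critic rows 1125 (β) / 1127 (ORDER OF RECORD for `stmt-AtomisticToContinuum-26636`, leaf (2) `SubWindowBudgetGlueBPG`): «make constants explicit in
sbOneStep; respect [SBᵇ]'s quantifier order».  This file assembles (E1) `comparison_estimate` (XI), (E2)+(E3) `mode_of_decay` / `excess_decay_step` /
`mode_size_step` (XJ) and the window geometry into ONE typed step of the index-side Campanato recursion (memo NODE-g59a §1, NODE-g59c §4) for the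
ITERATE `Ψ_j = transReg Ψ₀ a₀ b₀ w₀ a b w` of the original registration `Ψ₀` (chart 0 = `(a₀, b₀, w₀)`, chart j = `(a, b, w)`):

* XK.1 WINDOW GEOMETRY: the five side conditions of (E1) for the window `P = idxBallF X₀ n` — `ϱ`-near sites stay in `B_m` (co-Lipschitz), `nbhd1 P ⊆ B_m`,
  atoms of `P` lie in `ball x t` (chains, XD), index sites of `S ∩ ball x τ` lie in `B_m` (XF), for `m ≥ n + ϱ/c + 1`, `m ≥ (2τ + 8)·9/c`, `t > (28/25)(6C₀'n + 8)`.
* XK.2 INSTANTIATION: (PT) `LinearisationDefectP` ⇒ the residual identity of (E1) verbatim (`hPT_of_linearisationDefectP`, definitional); the gradient bound of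
  the iterate on `ϱ`-near pairs, `δs = (6C₀'ϱ/c + 8)((28/25)ω₁ + ϑ₁) + μϱ/c`, from coherence of `Ψ₀` (XE) and the drift `μ` of chart j (`norm_pullDisp_iterate_sub_le`).
* XK.3 ★★ `sbModeStep` — (E1)+(E2)+(E3) IN ONE STATEMENT, ALL CONSTANTS EXPLICIT: with the comparison error
  `compErr κ₁ dA dAϱ CT δs εf AT F E_m = 3·(dA²εf²E_m + dA·AT²·F + (½CT δs dAϱ)²E_m)/κ₁²` (`dA = dictA c 9`, `dAϱ = dictA c ϱ`, `F = Θ·nK(S ∩ ball x τ)/max(τ−t,1)²`,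
  `E_m = E(φ_j)(B_m)`), the (HC)/(LD) packages at `(κ₁, CL, ϱ, tC, n₁)` and the (I4ˢ) instance at the centre give a mode `M` of size `m_M` with
  `m_M²·#B_{tC n} ≤ CL(2 + 2CL tC²)(2E(φ_j)(B_n) + 2·compErr)` and, COUNT-NORMALISED (the `tC²` law survives division by `#B_{tC n}`),
  `E(φ_j − M)(B_{tC n}) ≤ 2·compErr + 2·(CL tC²·#B_{tC n}/#B_n)·(2E(φ_j)(B_n) + 2·compErr)`.
  Quantifier order: every constant is a FUNCTION of data fixed before [SBᵇ]'s `∀ S` (κ₁, CL, n₁, ϱ from XD `floor_packages`; CT from (I1); εf, AT from (I4ˢ);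
  dictA from (c, 9, ϱ)); only `E`, `Θ`, `nK` are instance data.
* XK.4 (E4) FOR THE ITERATION: `idxEnergy_pullDisp_iterate_le` (next excess ≤ 2E(φ_j − M) + 54L²#Q by functoriality `transReg_transReg` + XJ.3), the history
  comparison `idxEnergy_pullDisp_iterate_le_of_lipschitz` (two iterates differ by an index-Lipschitz field), and the drift update `isIdxLipschitz_drift_succ`
  (`μ_{j+1} ≤ μ_j + m_M + (C_R m_M² + ε m_M)`).
-/

noncomputable section

open scoped BigOperators InnerProductSpace RealInnerProductSpace
open Set Function Metric
open Summit.AtomisticToContinuum.Crystallization.Theorems.ChartedPlanarOrderRigidityDoor (E3 IsClean IsNash)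
open Summit.AtomisticToContinuum.Crystallization.Theorems.ChartedPlanarOrderDensityDichotomy (μS IsSep nK nK_nonneg)
open Summit.AtomisticToContinuum.Crystallization.Theorems.ChartedPlanarOrderCleanScaleP (IsCleanP isCleanP_one_iff)
open Summit.AtomisticToContinuum.Crystallization.Theorems.ChartedPlanarOrderDoorLayered (Layered)

namespace Summit.AtomisticToContinuum.Crystallization.Theorems.ChartedZeroExcessLayeredLatticeLiouville

/-! ### XK.1  Window geometry -/

section Window

variable {S : Set E3} {Ψ : E3 → E3} {a b : E3} {w : ℤ → E3} {c : ℝ}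

/-- Auxiliary step (`idxBallF` monotone). [formal bookkeeping] -/
theorem idxBallF_subset_idxBallF (X₀ : Cell 2 × ℤ) {n m : ℝ} (h : n ≤ m) : idxBallF X₀ n ⊆ idxBallF X₀ m :=
  fun _ hX => mem_idxBallF.2 ((mem_idxBallF.1 hX).trans h)

/-- `ϱ`-near sites of the window stay in the enlarged window (co-Lipschitz chart). [formal bookkeeping] -/
theorem mem_idxBallF_of_near (hc : 0 < c) (hcr : IsLayeredCrystal c a b w) {X₀ X Y : Cell 2 × ℤ} {n m ϱ : ℝ} (hX : X ∈ idxBallF X₀ n)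
    (hY : ‖lsite a b w Y.1 Y.2 - lsite a b w X.1 X.2‖ ≤ ϱ) (hm : n + ϱ / c ≤ m) : Y ∈ idxBallF X₀ m := by
  rw [mem_idxBallF] at hX ⊢
  have h1 : c * dist Y X ≤ ϱ := (hcr Y X).trans hY
  have h2 : dist Y X ≤ ϱ / c := by rw [le_div_iff₀ hc]; linarith [mul_comm c (dist Y X)]
  linarith [dist_triangle Y X X₀]

/-- the distance of `ϱ`-near sites (co-Lipschitz chart). [formal bookkeeping] -/
theorem dist_le_of_near (hc : 0 < c) (hcr : IsLayeredCrystal c a b w) {X Y : Cell 2 × ℤ} {ϱ : ℝ}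
    (hY : ‖lsite a b w Y.1 Y.2 - lsite a b w X.1 X.2‖ ≤ ϱ) : dist X Y ≤ ϱ / c := by
  rw [le_div_iff₀ hc, dist_comm]
  linarith [(hcr Y X).trans hY, mul_comm c (dist Y X)]

/-- the unit neighbourhood of the window lies in the enlarged window. [formal bookkeeping] -/
theorem nbhd1_idxBallF_subset (X₀ : Cell 2 × ℤ) {n m : ℝ} (hm : n + 1 ≤ m) : nbhd1 ↑(idxBallF X₀ n) ⊆ idxBall X₀ m := by
  rintro X ⟨Y, hY, hXY⟩
  rw [Finset.mem_coe, mem_idxBallF] at hY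
  rw [← coe_idxBallF, Finset.mem_coe, mem_idxBallF]
  linarith [dist_triangle X Y X₀]

/-- the atoms of the window lie in the ball `ball x t` about the centre atom (chains of chart 0, XD `image_atomOf_idxBall_subset`). [formal bookkeeping] -/
theorem atomOf_mem_ball_of_mem {C₁ : ℝ} (hbij : BijOn Ψ S (Layered a b w)) (hiso : IsBondIso S Ψ) (hH : IsClean (μS (Layered a b w)))
    (hT : IsTameIndexing C₁ a b w) (X₀ : Cell 2 × ℤ) {n t : ℝ} (ht : 28 / 25 * (6 * C₁ * n + 8) < t) {X : Cell 2 × ℤ} (hX : X ∈ idxBallF X₀ n) :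
    atomOf S Ψ a b w X ∈ ball (atomOf S Ψ a b w X₀) t :=
  (image_atomOf_idxBall_subset hbij hiso hH hT X₀ ht ⟨X, by rw [← coe_idxBallF]; exact Finset.mem_coe.2 hX, rfl⟩).2

/-- the index sites of `S ∩ ball x τ` about the centre atom lie in the enlarged window (XF `idxOf_mem_idxBall_of_mem`). [formal bookkeeping] -/
theorem idxOf_mem_idxBall_of_mem_ball (hS1 : IsCleanP 1 (μS S)) (hbij : BijOn Ψ S (Layered a b w)) (hc : 0 < c) (hcr : IsLayeredCrystal c a b w)
    {D : ℝ} (hD : 0 ≤ D) (h4D : ∀ x ∈ S, ∀ p ∈ S, dist p x ≤ 4 → dist (Ψ p) (Ψ x) ≤ D) (X₀ : Cell 2 × ℤ) {τ m : ℝ} (hτ : 0 ≤ τ)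
    (hm : (2 * τ + 8) * (D / c) ≤ m) {p : E3} (hp : p ∈ S ∩ ball (atomOf S Ψ a b w X₀) τ) : idxOf a b w (Ψ p) ∈ idxBall X₀ m := by
  have h := idxOf_mem_idxBall_of_mem hS1 hbij hc hcr hD h4D (atomOf_mem hbij X₀) hτ hp
  rw [idxOf_apply_atomOf hbij hc hcr X₀] at h
  exact idxBall_mono X₀ hm h

end Window

/-! ### XK.2  Instantiation: (PT), and the gradient bound of the iterate -/

section Instantiate

variable {S : Set E3} {Ψ₀ : E3 → E3} {a₀ b₀ a b : E3} {w₀ w : ℤ → E3} {c₀ c : ℝ}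

/-- (PT) `LinearisationDefectP` delivers the residual identity of (E1) VERBATIM (`atomOf = invFunOn Ψ S ∘ lsite`, `defectSum` = its right-hand side). -/
theorem hPT_of_linearisationDefectP (hPT : LinearisationDefectP) {δ : ℝ} (hδ : 0 < δ) (hsep : IsSep δ S) (hNash : IsNash (μS S)) {Ψ : E3 → E3}
    (hc : 0 < c) (hcr : IsLayeredCrystal c a b w) (hsepH : IsSep (27 / 32) (Layered a b w)) (hNashH : IsNash (μS (Layered a b w)))
    (hbij : BijOn Ψ S (Layered a b w)) {ϱ : ℝ} (hϱ : 0 < ϱ) (X : Cell 2 × ℤ) :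
    truncResidual ϱ a b w (pullDisp S Ψ a b w) X + tailForce ϱ S (Layered a b w) Ψ (atomOf S Ψ a b w X) =
      -defectSum ϱ a b w (pullDisp S Ψ a b w) X :=
  hPT δ hδ S hsep hNash c hc a b w hcr hsepH hNashH Ψ hbij ϱ hϱ X

/-- ★ the iterate's pulled-back displacement differs from chart 0's by the chart displacement: `φ_j Y − φ_j X = (φ₀ Y − φ₀ X) − (Δ Y − Δ X)`, `Δ = lsite − lsite₀`. -/
theorem pullDisp_iterate_sub (hbij₀ : BijOn Ψ₀ S (Layered a₀ b₀ w₀)) (hc₀ : 0 < c₀) (hcr₀ : IsLayeredCrystal c₀ a₀ b₀ w₀) (hc : 0 < c)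
    (hcr : IsLayeredCrystal c a b w) (X Y : Cell 2 × ℤ) :
    pullDisp S (transReg Ψ₀ a₀ b₀ w₀ a b w) a b w Y.1 Y.2 - pullDisp S (transReg Ψ₀ a₀ b₀ w₀ a b w) a b w X.1 X.2 =
      (pullDisp S Ψ₀ a₀ b₀ w₀ Y.1 Y.2 - pullDisp S Ψ₀ a₀ b₀ w₀ X.1 X.2) -
        ((lsite a b w Y.1 Y.2 - lsite a₀ b₀ w₀ Y.1 Y.2) - (lsite a b w X.1 X.2 - lsite a₀ b₀ w₀ X.1 X.2)) := by
  rw [pullDisp_transReg hbij₀ hc₀ hcr₀ hc hcr, pullDisp_eq_atomOf_sub S Ψ₀ a₀ b₀ w₀ X, pullDisp_eq_atomOf_sub S Ψ₀ a₀ b₀ w₀ Y]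
  simp only [Prod.mk.eta]
  abel

/-- ★ **GRADIENT BOUND OF THE ITERATE on `ϱ`-near pairs**: coherence of `Ψ₀` (XE `norm_pullDisp_sub_pullDisp_le`) + drift `μ` of chart j give
`‖φ_j e.1 − φ_j e.2‖ ≤ δs := (6C₀'ϱ/c + 8)((28/25)ω₁ + ϑ₁) + μϱ/c` on the `ϱ`-near pairs of the window (chart-j metric; `dist ≤ ϱ/c`). [this file, g59] -/
theorem norm_pullDisp_iterate_sub_le {C₀' ϑ₁ ω₁ μ ϱ : ℝ} {K : Set E3} (hbij₀ : BijOn Ψ₀ S (Layered a₀ b₀ w₀)) (hiso : IsBondIso S Ψ₀)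
    (hH₀ : IsClean (μS (Layered a₀ b₀ w₀))) (hT₀ : IsTameIndexing C₀' a₀ b₀ w₀) (hc₀ : 0 < c₀) (hcr₀ : IsLayeredCrystal c₀ a₀ b₀ w₀)
    (hcoh : IsCoherentBy ϑ₁ ω₁ S Ψ₀ K) (hω : 0 ≤ ω₁) (hϑ : 0 ≤ ϑ₁) (hc : 0 < c) (hcr : IsLayeredCrystal c a b w) (hμ0 : 0 ≤ μ)
    (hμ : IsIdxLipschitz μ (fun γ k => lsite a b w γ k - lsite a₀ b₀ w₀ γ k)) {U : Finset (Cell 2 × ℤ)}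
    (hK : ∀ X ∈ U, S ∩ closedBall (atomOf S Ψ₀ a₀ b₀ w₀ X) (28 / 25 * (6 * C₀' * (ϱ / c) + 8)) ⊆ K)
    {e : (Cell 2 × ℤ) × (Cell 2 × ℤ)} (he : e ∈ nearPairs a b w ϱ U) :
    ‖pullDisp S (transReg Ψ₀ a₀ b₀ w₀ a b w) a b w e.1.1 e.1.2 - pullDisp S (transReg Ψ₀ a₀ b₀ w₀ a b w) a b w e.2.1 e.2.2‖ ≤
      (6 * C₀' * (ϱ / c) + 8) * (28 / 25 * ω₁ + ϑ₁) + μ * (ϱ / c) := by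
  obtain ⟨h1, -, -, hnear⟩ := mem_nearPairs.1 he
  have hC₀ : 0 ≤ C₀' := (norm_nonneg _).trans hT₀.1
  have hd : dist e.1 e.2 ≤ ϱ / c := dist_le_of_near hc hcr hnear
  have hK' : S ∩ closedBall (atomOf S Ψ₀ a₀ b₀ w₀ e.1) (28 / 25 * (6 * C₀' * dist e.1 e.2 + 8)) ⊆ K :=
    (inter_subset_inter_right S (closedBall_subset_closedBall (by nlinarith))).trans (hK e.1 h1)
  have hg := norm_pullDisp_sub_pullDisp_le hbij₀ hiso hH₀ hT₀ hcoh hω hϑ e.1 e.2 hK'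
  have hΔ := hμ e.1 e.2
  rw [norm_sub_rev, pullDisp_iterate_sub hbij₀ hc₀ hcr₀ hc hcr e.1 e.2]
  have hω' : 0 ≤ 28 / 25 * ω₁ + ϑ₁ := by positivity
  calc _ ≤ ‖pullDisp S Ψ₀ a₀ b₀ w₀ e.2.1 e.2.2 - pullDisp S Ψ₀ a₀ b₀ w₀ e.1.1 e.1.2‖ +
        ‖(lsite a b w e.2.1 e.2.2 - lsite a₀ b₀ w₀ e.2.1 e.2.2) - (lsite a b w e.1.1 e.1.2 - lsite a₀ b₀ w₀ e.1.1 e.1.2)‖ := norm_sub_le _ _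
    _ ≤ (6 * C₀' * dist e.1 e.2 + 8) * (28 / 25 * ω₁ + ϑ₁) + μ * dist e.1 e.2 := add_le_add hg hΔ
    _ ≤ (6 * C₀' * (ϱ / c) + 8) * (28 / 25 * ω₁ + ϑ₁) + μ * (ϱ / c) := by
        have h3 : (6 * C₀' * dist e.1 e.2 + 8) * (28 / 25 * ω₁ + ϑ₁) ≤ (6 * C₀' * (ϱ / c) + 8) * (28 / 25 * ω₁ + ϑ₁) :=
          mul_le_mul_of_nonneg_right (by nlinarith) hω'
        have h4 : μ * dist e.1 e.2 ≤ μ * (ϱ / c) := mul_le_mul_of_nonneg_left hd hμ0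
        linarith

end Instantiate

/-! ### XK.3  The one-step theorem -/

/-- ★ THE COMPARISON-ERROR CONSTANT of one step (explicit): `compErr κ₁ dA dAϱ CT δs εf AT F E_m = 3·(dA²·εf²·E_m + dA·AT²·F + (½·CT·δs·dAϱ)²·E_m)/κ₁²`
— the square of (E1)'s right-hand side over `κ₁`, with `F = Θ·nK(S ∩ ball x τ)/max(τ − t, 1)²`. [this file, g59] -/
def compErr (κ₁ dA dAϱ CT δs εf AT F Em : ℝ) : ℝ :=
  3 * (dA ^ 2 * εf ^ 2 * Em + dA * AT ^ 2 * F + (1 / 2 * CT * δs * dAϱ) ^ 2 * Em) / κ₁ ^ 2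

/-- Auxiliary step (`compErr` is non-negative for non-negative data). [formal bookkeeping] -/
theorem compErr_nonneg {κ₁ dA dAϱ CT δs εf AT F Em : ℝ} (hdA : 0 ≤ dA) (hF : 0 ≤ F) (hEm : 0 ≤ Em) :
    0 ≤ compErr κ₁ dA dAϱ CT δs εf AT F Em := by
  unfold compErr
  positivity

/-- squaring a three-term square-root bound. [formal bookkeeping] -/
theorem le_three_sq_div_of_sqrt_le {κ W p q r : ℝ} (hκ : 0 < κ) (hW : 0 ≤ W) (hpqr : 0 ≤ p + q + r)
    (h : κ * Real.sqrt W ≤ p + q + r) : W ≤ 3 * (p ^ 2 + q ^ 2 + r ^ 2) / κ ^ 2 := by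
  rw [le_div_iff₀ (by positivity)]
  have h1 : 0 ≤ κ * Real.sqrt W := by positivity
  have h2 : (κ * Real.sqrt W) ^ 2 ≤ (p + q + r) ^ 2 := by nlinarith
  rw [mul_pow, Real.sq_sqrt hW] at h2
  nlinarith [sq_nonneg (p - q), sq_nonneg (q - r), sq_nonneg (p - r)]

section Step

variable {S : Set E3} {Ψ₀ : E3 → E3} {a₀ b₀ a b : E3} {w₀ w : ℤ → E3} {c₀ c : ℝ}

/-- ★★★ **`sbModeStep` — ONE STEP (E1)+(E2)+(E3) OF THE INDEX-SIDE CAMPANATO RECURSION, ALL CONSTANTS EXPLICIT** (critic rows 1125 (β)/1127).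
Data: the door-set side (`δ`-separated, clean, Nash); chart 0 `(a₀,b₀,w₀)` with the ORIGINAL registration `Ψ₀` (bond isomorphism, coherence on `K`, tame
constant `C₀'`) — it supplies the fixed atom map and all chain geometry; chart j `(a,b,w)` (co-Lipschitz `c`, clean, Nash) at drift `μ` from chart 0, its
registration `Ψ_j = transReg Ψ₀ a₀ b₀ w₀ a b w` being `4 ↦ 9` tear-free; the packages (PT), (I1)'s constant `CT`, (HC) `HCPackage κ₁ ϱ`, (LD) `ModalDecayAt CL ϱ tC n₁`
+ `ModeRigidAt CL ϱ n₁` for chart j; scales `n` (window), `m` (comparison window), `t < τ` (E3 radii about the centre atom `x = atomOf X₀`); the (I4ˢ)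
instance at `(x, t, τ, Θ)` for `Ψ_j`.  Conclusion: a mode `M` (`IsTruncMode`) of size `m_M` with the two explicit inequalities of the module docstring.
[this file, g59] -/
theorem sbModeStep
    {δ : ℝ} (hδ : 0 < δ) (hsep : IsSep δ S) (hS1 : IsCleanP 1 (μS S)) (hNash : IsNash (μS S))
    {C₀' : ℝ} (hbij₀ : BijOn Ψ₀ S (Layered a₀ b₀ w₀)) (hiso : IsBondIso S Ψ₀) (hH₀ : IsClean (μS (Layered a₀ b₀ w₀)))
    (hT₀ : IsTameIndexing C₀' a₀ b₀ w₀) (hc₀ : 0 < c₀) (hcr₀ : IsLayeredCrystal c₀ a₀ b₀ w₀)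
    {ϑ₁ ω₁ : ℝ} {K : Set E3} (hcoh : IsCoherentBy ϑ₁ ω₁ S Ψ₀ K) (hω : 0 ≤ ω₁) (hϑ : 0 ≤ ϑ₁)
    (hc : 0 < c) (hcr : IsLayeredCrystal c a b w) (hH : IsClean (μS (Layered a b w))) (hNashH : IsNash (μS (Layered a b w)))
    {μ : ℝ} (hμ0 : 0 ≤ μ) (hμ : IsIdxLipschitz μ (fun γ k => lsite a b w γ k - lsite a₀ b₀ w₀ γ k))
    (h4D : ∀ x ∈ S, ∀ p ∈ S, dist p x ≤ 4 → dist (transReg Ψ₀ a₀ b₀ w₀ a b w p) (transReg Ψ₀ a₀ b₀ w₀ a b w x) ≤ 9)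
    (hLin : LinearisationDefectP) {CT : ℝ} (hCT0 : 0 ≤ CT) (hCT : ∀ z v : E3, 27 / 32 ≤ ‖z‖ → ‖v‖ ≤ 1 / 4 → ‖defectKernel z v‖ ≤ CT * ‖v‖ ^ 2)
    {κ₁ ϱ CL tC n₁ : ℝ} (hκ₁ : 0 < κ₁) (hϱ : 0 < ϱ) (hHC : HCPackage κ₁ ϱ a b w) (hCL : 0 ≤ CL) (htC0 : 0 ≤ tC) (htC1 : tC ≤ 1)
    (hMD : ModalDecayAt CL ϱ tC n₁ a b w) (hMR : ModeRigidAt CL ϱ n₁ a b w)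
    {X₀ : Cell 2 × ℤ} {n m t τ : ℝ} (hn₁ : n₁ ≤ tC * n) (hn : 0 ≤ n) (hm₁ : n + ϱ / c + 1 ≤ m) (hm₂ : (2 * τ + 8) * (9 / c) ≤ m)
    (ht : 28 / 25 * (6 * C₀' * n + 8) < t) (hτ : 0 ≤ τ)
    (hK : ∀ X ∈ idxBallF X₀ m, S ∩ closedBall (atomOf S Ψ₀ a₀ b₀ w₀ X) (28 / 25 * (6 * C₀' * (ϱ / c) + 8)) ⊆ K)
    (hδs : (6 * C₀' * (ϱ / c) + 8) * (28 / 25 * ω₁ + ϑ₁) + μ * (ϱ / c) ≤ 1 / 4)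
    {Θ εf AT : ℝ} (hΘ : 0 ≤ Θ) (hεf : 0 ≤ εf) (hAT : 0 ≤ AT)
    (hI4 : ∀ g : E3 → E3, (∀ y, y ∉ S ∩ ball (atomOf S Ψ₀ a₀ b₀ w₀ X₀) t → g y = 0) →
      |∑ᶠ y ∈ S ∩ ball (atomOf S Ψ₀ a₀ b₀ w₀ X₀) t, ⟪tailForce ϱ S (Layered a b w) (transReg Ψ₀ a₀ b₀ w₀ a b w) y, g y⟫_ℝ| ≤
        (εf * Real.sqrt (bondEnergy (S ∩ ball (atomOf S Ψ₀ a₀ b₀ w₀ X₀) τ) (fun p => p - transReg Ψ₀ a₀ b₀ w₀ a b w p)) +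
            AT * Real.sqrt (Θ * nK (S ∩ ball (atomOf S Ψ₀ a₀ b₀ w₀ X₀) τ)) / max (τ - t) 1) *
          Real.sqrt (bondEnergy (S ∩ ball (atomOf S Ψ₀ a₀ b₀ w₀ X₀) τ) g)) :
    ∃ M : Cell 2 → ℤ → E3, ∃ mM : ℝ, IsTruncMode ϱ a b w M ∧ 0 ≤ mM ∧ IsIdxLipschitz mM M ∧
      mM ^ 2 * ((idxBall X₀ (tC * n)).ncard : ℝ) ≤
        CL * (2 + 2 * (CL * tC ^ 2)) * (2 * idxEnergy (pullDisp S (transReg Ψ₀ a₀ b₀ w₀ a b w) a b w) (idxBall X₀ n) +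
          2 * compErr κ₁ (dictA c 9) (dictA c ϱ) CT ((6 * C₀' * (ϱ / c) + 8) * (28 / 25 * ω₁ + ϑ₁) + μ * (ϱ / c)) εf AT
            (Θ * nK (S ∩ ball (atomOf S Ψ₀ a₀ b₀ w₀ X₀) τ) / max (τ - t) 1 ^ 2)
            (idxEnergy (pullDisp S (transReg Ψ₀ a₀ b₀ w₀ a b w) a b w) (idxBall X₀ m))) ∧
      idxEnergy (pullDisp S (transReg Ψ₀ a₀ b₀ w₀ a b w) a b w - M) (idxBall X₀ (tC * n)) ≤
        2 * compErr κ₁ (dictA c 9) (dictA c ϱ) CT ((6 * C₀' * (ϱ / c) + 8) * (28 / 25 * ω₁ + ϑ₁) + μ * (ϱ / c)) εf AT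
            (Θ * nK (S ∩ ball (atomOf S Ψ₀ a₀ b₀ w₀ X₀) τ) / max (τ - t) 1 ^ 2)
            (idxEnergy (pullDisp S (transReg Ψ₀ a₀ b₀ w₀ a b w) a b w) (idxBall X₀ m)) +
          2 * (CL * tC ^ 2 * ((idxBall X₀ (tC * n)).ncard : ℝ) / ((idxBall X₀ n).ncard : ℝ)) *
            (2 * idxEnergy (pullDisp S (transReg Ψ₀ a₀ b₀ w₀ a b w) a b w) (idxBall X₀ n) +
            2 * compErr κ₁ (dictA c 9) (dictA c ϱ) CT ((6 * C₀' * (ϱ / c) + 8) * (28 / 25 * ω₁ + ϑ₁) + μ * (ϱ / c)) εf AT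
              (Θ * nK (S ∩ ball (atomOf S Ψ₀ a₀ b₀ w₀ X₀) τ) / max (τ - t) 1 ^ 2)
              (idxEnergy (pullDisp S (transReg Ψ₀ a₀ b₀ w₀ a b w) a b w) (idxBall X₀ m))) := by
  -- names
  set Ψj : E3 → E3 := transReg Ψ₀ a₀ b₀ w₀ a b w with hΨj
  set φ : Cell 2 → ℤ → E3 := pullDisp S Ψj a b w with hφ
  set x : E3 := atomOf S Ψ₀ a₀ b₀ w₀ X₀ with hx
  set δs : ℝ := (6 * C₀' * (ϱ / c) + 8) * (28 / 25 * ω₁ + ϑ₁) + μ * (ϱ / c) with hδsdef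
  set P : Finset (Cell 2 × ℤ) := idxBallF X₀ n with hP
  set dA : ℝ := dictA c 9 with hdA
  set Em : ℝ := idxEnergy φ (idxBall X₀ m) with hEm
  set En : ℝ := idxEnergy φ (idxBall X₀ n) with hEn
  set F : ℝ := Θ * nK (S ∩ ball x τ) / max (τ - t) 1 ^ 2 with hF
  have hbijj : BijOn Ψj S (Layered a b w) := bijOn_transReg hbij₀ hc₀ hcr₀ hc hcr
  have hsepH : IsSep (27 / 32) (Layered a b w) := isSep_of_isClean hH
  have hC₀ : 0 ≤ C₀' := (norm_nonneg _).trans hT₀.1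
  have hδs0 : 0 ≤ δs := by rw [hδsdef]; positivity
  have hdA0 : 0 ≤ dA := dictA_nonneg c 9
  have hdAϱ : 0 ≤ dictA c ϱ := dictA_nonneg c ϱ
  have hEm0 : 0 ≤ Em := idxEnergy_nonneg _ _
  have hEn0 : 0 ≤ En := idxEnergy_nonneg _ _
  have hMx : 0 < max (τ - t) 1 := lt_max_of_lt_right one_pos
  have hnK : 0 ≤ nK (S ∩ ball x τ) := nK_nonneg _
  have hF0 : 0 ≤ F := by rw [hF]; positivity
  have hxS : x ∈ S := atomOf_mem hbij₀ X₀
  have hatom : ∀ X : Cell 2 × ℤ, atomOf S Ψj a b w X = atomOf S Ψ₀ a₀ b₀ w₀ X := fun X => atomOf_transReg hbij₀ hc₀ hcr₀ hc hcr X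
  have htn : tC * n ≤ n := by nlinarith
  have htn0 : 0 ≤ tC * n := by positivity
  have hϱc : 0 ≤ ϱ / c := div_nonneg hϱ.le hc.le
  have hnm : n ≤ m := by linarith
  -- (HC): the comparison field
  obtain ⟨V, hVoff, hVh, hHCineq⟩ := hHC (↑P) P.finite_toSet φ
  have hVh' : IsTruncHarmonicZ ϱ a b w V (idxBall X₀ n) := by rw [← coe_idxBallF]; exact hVh
  -- (PT) for chart j
  have hPTj : ∀ X : Cell 2 × ℤ, truncResidual ϱ a b w φ X + tailForce ϱ S (Layered a b w) Ψj (atomOf S Ψj a b w X) = -defectSum ϱ a b w φ X :=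
    fun X => hPT_of_linearisationDefectP hLin hδ hsep hNash hc hcr hsepH hNashH hbijj hϱ X
  -- window geometry
  have hPm : P ⊆ idxBallF X₀ m := idxBallF_subset_idxBallF X₀ hnm
  have hPU : ∀ X ∈ P, ∀ Y : Cell 2 × ℤ, ‖lsite a b w Y.1 Y.2 - lsite a b w X.1 X.2‖ ≤ ϱ → Y ∈ idxBallF X₀ m :=
    fun X hX Y hY => mem_idxBallF_of_near hc hcr hX hY (by linarith)
  have hP1 : nbhd1 ↑P ⊆ idxBall X₀ m := nbhd1_idxBallF_subset X₀ (by linarith)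
  have hgrad : ∀ e ∈ nearPairs a b w ϱ (idxBallF X₀ m), ‖φ e.1.1 e.1.2 - φ e.2.1 e.2.2‖ ≤ δs :=
    fun e he => norm_pullDisp_iterate_sub_le hbij₀ hiso hH₀ hT₀ hc₀ hcr₀ hcoh hω hϑ hc hcr hμ0 hμ hK he
  have hPt : ∀ X ∈ P, atomOf S Ψj a b w X ∈ ball x t := fun X hX => by
    rw [hatom X]
    exact atomOf_mem_ball_of_mem hbij₀ hiso hH₀ hT₀ X₀ ht hX
  have hτm : ∀ p ∈ S ∩ ball x τ, idxOf a b w (Ψj p) ∈ idxBall X₀ m := fun p hp => by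
    have hp' : p ∈ S ∩ ball (atomOf S Ψj a b w X₀) τ := by rw [hatom X₀]; exact hp
    exact idxOf_mem_idxBall_of_mem_ball hS1 hbijj hc hcr (by norm_num) h4D X₀ hτ hm₂ hp'
  -- (E1)
  have hE1 := comparison_estimate hbijj hc hcr hsepH hδ hsep h4D hCT0 hCT hPTj hPm hPU hP1 hδs0 hδs hgrad hVoff hHCineq hεf hAT hPt hτm hI4
  set W : ℝ := idxEnergy (φ - V) (nbhd1 ↑P) with hW
  have hW0 : 0 ≤ W := idxEnergy_nonneg _ _
  have hWle : W ≤ compErr κ₁ dA (dictA c ϱ) CT δs εf AT F Em := by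
    have h1 : κ₁ * Real.sqrt W ≤ Real.sqrt dA * (εf * Real.sqrt (dA * Em)) + Real.sqrt dA * (AT * Real.sqrt (Θ * nK (S ∩ ball x τ)) / max (τ - t) 1) +
        1 / 2 * CT * δs * dictA c ϱ * Real.sqrt Em := by rw [← mul_add]; exact hE1
    have h2 := le_three_sq_div_of_sqrt_le hκ₁ hW0 (by positivity) h1
    have e1 : (Real.sqrt dA * (εf * Real.sqrt (dA * Em))) ^ 2 = dA ^ 2 * εf ^ 2 * Em := by
      rw [mul_pow, mul_pow, Real.sq_sqrt hdA0, Real.sq_sqrt (by positivity)]; ring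
    have e2 : (Real.sqrt dA * (AT * Real.sqrt (Θ * nK (S ∩ ball x τ)) / max (τ - t) 1)) ^ 2 = dA * AT ^ 2 * F := by
      rw [mul_pow, div_pow, mul_pow, Real.sq_sqrt hdA0, Real.sq_sqrt (by positivity), hF]; ring
    have e3 : (1 / 2 * CT * δs * dictA c ϱ * Real.sqrt Em) ^ 2 = (1 / 2 * CT * δs * dictA c ϱ) ^ 2 * Em := by
      rw [mul_pow, Real.sq_sqrt hEm0]
    rw [e1, e2, e3] at h2
    exact h2
  -- the comparison error on the two balls
  have hψP : ∀ X : Cell 2 × ℤ, X ∉ (↑P : Set (Cell 2 × ℤ)) → (φ - V) X.1 X.2 = 0 := fun X hX => by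
    simp only [Pi.sub_apply]
    rw [hVoff X hX, sub_self]
  have hWm : idxEnergy (φ - V) (idxBall X₀ m) = W := idxEnergy_eq_nbhd1_of_vanish hψP hP1
  have hWn : idxEnergy (φ - V) (idxBall X₀ n) ≤ compErr κ₁ dA (dictA c ϱ) CT δs εf AT F Em :=
    ((idxEnergy_mono_set (idxBall_mono X₀ hnm) (finite_idxBall X₀ m) _).trans hWm.le).trans hWle
  have hWt : idxEnergy (φ - V) (idxBall X₀ (tC * n)) ≤ compErr κ₁ dA (dictA c ϱ) CT δs εf AT F Em :=
    ((idxEnergy_mono_set (idxBall_mono X₀ (htn.trans hnm)) (finite_idxBall X₀ m) _).trans hWm.le).trans hWle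
  -- (E2)+(E3)
  obtain ⟨M, mM, hMode, hm0, hLip, hsize, hdec⟩ := mode_of_decay hMD hMR hCL (hn₁.trans htn) hn₁ htn0 X₀ hVh'
  have hCE0 : 0 ≤ compErr κ₁ dA (dictA c ϱ) CT δs εf AT F Em := compErr_nonneg hdA0 hF0 hEm0
  have hNn : (0 : ℝ) < ((idxBall X₀ n).ncard : ℝ) := ncard_idxBall_pos X₀ hn
  have hK1 : CL * tC ^ 2 * ((idxBall X₀ (tC * n)).ncard : ℝ) / ((idxBall X₀ n).ncard : ℝ) ≤ CL * tC ^ 2 := by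
    rw [div_le_iff₀ hNn]
    have hle : ((idxBall X₀ (tC * n)).ncard : ℝ) ≤ ((idxBall X₀ n).ncard : ℝ) := by
      exact_mod_cast Set.ncard_le_ncard (idxBall_mono X₀ htn) (finite_idxBall X₀ n)
    exact mul_le_mul_of_nonneg_left hle (by positivity)
  have hsum0 : 0 ≤ 2 * En + 2 * compErr κ₁ dA (dictA c ϱ) CT δs εf AT F Em := by positivity
  refine ⟨M, mM, hMode, hm0, hLip, ?_, ?_⟩
  · have h := mode_size_step hCL htC1 hn φ V M X₀ hsize hdec hWn
    calc mM ^ 2 * ((idxBall X₀ (tC * n)).ncard : ℝ) ≤ _ := h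
      _ ≤ CL * (2 + 2 * (CL * tC ^ 2)) * (2 * En + 2 * compErr κ₁ dA (dictA c ϱ) CT δs εf AT F Em) := by
          apply mul_le_mul_of_nonneg_right _ hsum0
          exact mul_le_mul_of_nonneg_left (by linarith) hCL
  · exact excess_decay_step hCL hn φ V M X₀ hdec hWt hWn

end Step

/-! ### XK.4  (E4) for the iteration: next excess, history comparison, drift update -/

section Iterate

variable {S : Set E3} {Ψ₀ : E3 → E3} {a₀ b₀ a b a' b' : E3} {w₀ w w' : ℤ → E3} {c₀ c c' : ℝ}

/-- ★ **(E4) THE NEXT EXCESS**: `E(φ_{j+1})(Q) ≤ 2·E(φ_j − M)(Q) + 54·L²·#Q` for `Ψ_{j+1} = transReg Ψ₀ a₀ b₀ w₀ a' b' w'` whenever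
`lsite' − lsite − M` is `L`-index-Lipschitz ((RC)'s output; functoriality `transReg_transReg` + XJ.3). [this file, g59] -/
theorem idxEnergy_pullDisp_iterate_le (hbij₀ : BijOn Ψ₀ S (Layered a₀ b₀ w₀)) (hc₀ : 0 < c₀) (hcr₀ : IsLayeredCrystal c₀ a₀ b₀ w₀) (hc : 0 < c)
    (hcr : IsLayeredCrystal c a b w) (hc' : 0 < c') (hcr' : IsLayeredCrystal c' a' b' w') {M : Cell 2 → ℤ → E3} {L : ℝ}
    (hAM : ∀ X Y : Cell 2 × ℤ, ‖(lsite a' b' w' Y.1 Y.2 - lsite a b w Y.1 Y.2 - M Y.1 Y.2) -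
      (lsite a' b' w' X.1 X.2 - lsite a b w X.1 X.2 - M X.1 X.2)‖ ≤ L * dist X Y) (Q : Finset (Cell 2 × ℤ)) :
    idxEnergy (pullDisp S (transReg Ψ₀ a₀ b₀ w₀ a' b' w') a' b' w') ↑Q ≤
      2 * idxEnergy (pullDisp S (transReg Ψ₀ a₀ b₀ w₀ a b w) a b w - M) ↑Q + 54 * L ^ 2 * Q.card := by
  have hbijj : BijOn (transReg Ψ₀ a₀ b₀ w₀ a b w) S (Layered a b w) := bijOn_transReg hbij₀ hc₀ hcr₀ hc hcr
  have e : transReg Ψ₀ a₀ b₀ w₀ a' b' w' = transReg (transReg Ψ₀ a₀ b₀ w₀ a b w) a b w a' b' w' :=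
    funext fun p => (transReg_transReg hc hcr p).symm
  rw [e]
  exact idxEnergy_pullDisp_transReg_le hbijj hc hcr hc' hcr' hAM Q

/-- ★ HISTORY COMPARISON: two iterates differ by the index-Lipschitz chart displacement, so `E(φ_k)(Q) ≤ 2·E(φ_j)(Q) + 54·Δ²·#Q` whenever `lsite_k − lsite_j` is
`Δ`-index-Lipschitz (used by the scalar recursion for the comparison window `B_m ⊆ B_{n_{j−k₀}}`). [this file, g59] -/
theorem idxEnergy_pullDisp_iterate_le_of_lipschitz (hbij₀ : BijOn Ψ₀ S (Layered a₀ b₀ w₀)) (hc₀ : 0 < c₀) (hcr₀ : IsLayeredCrystal c₀ a₀ b₀ w₀)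
    (hc : 0 < c) (hcr : IsLayeredCrystal c a b w) (hc' : 0 < c') (hcr' : IsLayeredCrystal c' a' b' w') {Δ : ℝ}
    (hΔ : IsIdxLipschitz Δ (fun γ k => lsite a' b' w' γ k - lsite a b w γ k)) (Q : Finset (Cell 2 × ℤ)) :
    idxEnergy (pullDisp S (transReg Ψ₀ a₀ b₀ w₀ a' b' w') a' b' w') ↑Q ≤
      2 * idxEnergy (pullDisp S (transReg Ψ₀ a₀ b₀ w₀ a b w) a b w) ↑Q + 54 * Δ ^ 2 * Q.card := by
  have h := idxEnergy_pullDisp_iterate_le hbij₀ hc₀ hcr₀ hc hcr hc' hcr' (M := 0) (L := Δ) (fun X Y => by simpa using hΔ X Y) Q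
  rwa [sub_zero] at h

/-- ★ DRIFT UPDATE: `lsite_{j+1} − lsite₀` is `(μ + m_M + L)`-index-Lipschitz. [this file, g59] -/
theorem isIdxLipschitz_drift_succ {μ mM L : ℝ} {M : Cell 2 → ℤ → E3} (hμ : IsIdxLipschitz μ (fun γ k => lsite a b w γ k - lsite a₀ b₀ w₀ γ k))
    (hM : IsIdxLipschitz mM M)
    (hAM : ∀ X Y : Cell 2 × ℤ, ‖(lsite a' b' w' Y.1 Y.2 - lsite a b w Y.1 Y.2 - M Y.1 Y.2) -
      (lsite a' b' w' X.1 X.2 - lsite a b w X.1 X.2 - M X.1 X.2)‖ ≤ L * dist X Y) :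
    IsIdxLipschitz (μ + mM + L) (fun γ k => lsite a' b' w' γ k - lsite a₀ b₀ w₀ γ k) := by
  intro X Y
  have e : (lsite a' b' w' Y.1 Y.2 - lsite a₀ b₀ w₀ Y.1 Y.2) - (lsite a' b' w' X.1 X.2 - lsite a₀ b₀ w₀ X.1 X.2) =
      ((lsite a b w Y.1 Y.2 - lsite a₀ b₀ w₀ Y.1 Y.2) - (lsite a b w X.1 X.2 - lsite a₀ b₀ w₀ X.1 X.2)) +
        (M Y.1 Y.2 - M X.1 X.2) +
        ((lsite a' b' w' Y.1 Y.2 - lsite a b w Y.1 Y.2 - M Y.1 Y.2) - (lsite a' b' w' X.1 X.2 - lsite a b w X.1 X.2 - M X.1 X.2)) := by abel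
  simp only
  rw [e]
  refine (norm_add₃_le).trans ?_
  have h1 := hμ X Y
  have h2 := hM X Y
  have h3 := hAM X Y
  simp only at h1
  linarith

/-- the consecutive-chart displacement `lsite_{j+1} − lsite_j` is `(m_M + L)`-index-Lipschitz (input of XE `tearFree_transReg` / `dist_transReg_le` between
consecutive iterates). [formal bookkeeping] -/
theorem isIdxLipschitz_consecutive {mM L : ℝ} {M : Cell 2 → ℤ → E3} (hM : IsIdxLipschitz mM M)
    (hAM : ∀ X Y : Cell 2 × ℤ, ‖(lsite a' b' w' Y.1 Y.2 - lsite a b w Y.1 Y.2 - M Y.1 Y.2) -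
      (lsite a' b' w' X.1 X.2 - lsite a b w X.1 X.2 - M X.1 X.2)‖ ≤ L * dist X Y) :
    IsIdxLipschitz (mM + L) (fun γ k => lsite a' b' w' γ k - lsite a b w γ k) := by
  have h0 : IsIdxLipschitz 0 (fun γ k => lsite a b w γ k - lsite a b w γ k) := fun X Y => by simp
  have h := isIdxLipschitz_drift_succ h0 hM hAM
  rwa [zero_add] at h

end Iterate

end Summit.AtomisticToContinuum.Crystallization.Theorems.ChartedZeroExcessLayeredLatticeLiouville

end
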